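import Literature.Analysis.OperatorTheory.YangMillsMatrixModelGroundStateSign
import HarnessLib

/-!
# Eigenfunctions of Lüscher's matrix-model Hamiltonian cannot vanish on a large ball (valley confinement ⇒ interior support)

Topic `Literature/Analysis/OperatorTheory`; companion of `YangMillsMatrixModelValleyBound.lean` (`integral_norm_sq_le_energyForm`:
`⅔∫‖x‖ψ² ≤ 𝔮(ψ)` on `C²_c`, B. Simon 1983 eq. (5)) and `YangMillsMatrixModelCutoffEnergy.lean` (`energyForm_testFn_mul_of_eigen`:
`𝔮(χψ) = E∫χ²ψ² + ½∫‖∇χ‖²ψ²`, Agmon (1.16″)).  For a `C²` solution of `𝔥ψ = Eψ` (any real `E`) with `|ψ| ≤ Ce^{−‖x‖}` and `∫ψ² = 1`: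

* `valley_cutoff_ineq` — for every cut-off radius `R' ≥ 1`: `⅔∫‖x‖χ_{R'}²ψ² ≤ E∫χ_{R'}²ψ² + ½∫‖∇χ_{R'}‖²ψ²`;
* ★ `exists_ne_zero_in_ball` — **if `R > 3E/2` then `ψ(y) ≠ 0` for some `‖y‖ < R`**: an eigenfunction at level `E` cannot vanish identically on
  the ball of radius `3E/2` (were `ψ ≡ 0` on `‖x‖ < R`, the valley bound applied to `χ_{R'}ψ` would give `(⅔R − E)∫χ_{R'}²ψ² ≤ ½∫‖∇χ_{R'}‖²ψ² =
  O(e^{−R'})` while `∫χ_{R'}²ψ² → 1`).  UNIFORM in `ψ`: the radius depends on the level only — the substitute, inside the tree's first-moment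
  technology, for unique continuation; used by the femto-universe line «polyakovlift» (crux `DressedRitz`, stmt-QuantumFields-20205, r6) to show
  that the cut-off transplants `χ_R f_{i+1}/f_0` of AL1 eigenfamilies are not identically zero once `R > 3·physLevel(i+2)/2`;
* `exists_ne_zero_in_ball_of_clauses` — the same for member `j` of a family with the AL1 clauses (`E = physLevel (j+1) ≥ 0`).

Theorems only; no definitions, no named facts.
## References
* [SimonB1983DiscreteSpectrum] B. Simon, Ann. Phys. 146 (1983) 209–220, §2 eq. (5) (valley confinement `𝔥 ≥ ⅔‖x‖`).
* [Agmon1982] S. Agmon, *Lectures on Exponential Decay…*, (1.16″) (cut-off energy identity), Cor. 4.5.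
* [ReedSimonIV1978] M. Reed, B. Simon, *Methods of Modern Mathematical Physics IV*, Thm. XIII.57 (unique continuation — the classical route, not used).
-/

noncomputable section

open MeasureTheory Filter Topology
open scoped BigOperators

namespace Literature.Analysis.OperatorTheory.YMMatrixModel

/-- **Valley bound for a cut-off eigenfunction**: for a `C²` solution of `𝔥ψ = Eψ` and a `C²_c` cut-off `χ`,
`⅔∫‖x‖χ²ψ² ≤ E∫χ²ψ² + ½∫‖∇χ‖²ψ²`. [cite: SimonB1983DiscreteSpectrum, §2 eq. (5)] [cite: Agmon1982, (1.16″)] -/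
theorem valley_cutoff_ineq {ψ : ZM → ℝ} (hψ : ContDiff ℝ 2 ψ) {E : ℝ} (heig : ∀ x, hApply ψ x = E * ψ x)
    {χ : ZM → ℝ} (hχ : IsTestFn χ) :
    (2 / 3 : ℝ) * ∫ x, ‖x‖ * (χ x ^ 2 * ψ x ^ 2) ≤
      E * (∫ x, χ x ^ 2 * ψ x ^ 2) + (1 / 2 : ℝ) * ∫ x, ‖gradient χ x‖ ^ 2 * ψ x ^ 2 := by
  have heig' : ∀ x : ZM, -(1 / 2 : ℝ) * (∑ p, pderiv p (pderiv p ψ) x) + luscherPotential x * ψ x = E * ψ x :=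
    fun x => (hApply_eq_iff x).mp (heig x)
  have htest : IsTestFn (χ * ψ) := ⟨hχ.1.mul hψ, hχ.2.mul_right⟩
  have h1 := integral_norm_sq_le_energyForm htest
  have h2 := energyForm_testFn_mul_of_eigen hχ hψ heig'
  have h3 : (∫ x, ‖x‖ * (χ * ψ) x ^ 2) = ∫ x, ‖x‖ * (χ x ^ 2 * ψ x ^ 2) :=
    integral_congr_ae (Eventually.of_forall fun x => by simp only [Pi.mul_apply, mul_pow])
  rw [h3, h2] at h1
  exact h1

/-- ★ **An eigenfunction at level `E` does not vanish identically on the ball of radius `> 3E/2`.**  For a `C²` solution of `𝔥ψ = Eψ`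
(any real `E`) with `|ψ| ≤ Ce^{−‖x‖}` and `∫ψ² = 1`: if `3E/2 < R` then `ψ(y) ≠ 0` for some `‖y‖ < R`.  Uniform in `ψ` (the radius depends on
`E` only). [cite: SimonB1983DiscreteSpectrum, §2 eq. (5)] [cite: Agmon1982, (1.16″), Cor. 4.5] -/
theorem exists_ne_zero_in_ball {ψ : ZM → ℝ} (hψ : ContDiff ℝ 2 ψ) {E : ℝ}
    (heig : ∀ x, hApply ψ x = E * ψ x) {C : ℝ} (hC : ∀ x, |ψ x| ≤ C * Real.exp (-‖x‖))
    (hnorm : l2sq ψ = 1) {R : ℝ} (hR : 3 / 2 * E < R) : ∃ y : ZM, ‖y‖ < R ∧ ψ y ≠ 0 := by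
  by_contra hcon
  have hzero : ∀ y : ZM, ‖y‖ < R → ψ y = 0 := fun y hy => by
    by_contra h
    exact hcon ⟨y, hy, h⟩
  obtain ⟨M₁, hM₁0, hpack⟩ := radialCutoff_package
  set K : ℝ := ∫ x : ZM, Real.exp (-‖x‖) with hK
  have hK0 : 0 ≤ K := integral_nonneg fun x => (Real.exp_pos _).le
  have hC0 : 0 ≤ C := by
    have h := (abs_nonneg _).trans (hC 0)
    rw [norm_zero, neg_zero, Real.exp_zero, mul_one] at h
    exact h
  have hδ : 0 < 2 / 3 * R - E := by linarith
  -- integrability of `ψ²` (decay) and the normalisation as an integral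
  have hψL2 : MemLp ψ 2 (volume : Measure ZM) := memLp_two_of_abs_le_exp hψ.continuous hC
  have hint_sq : Integrable (fun x => ψ x ^ 2) (volume : Measure ZM) :=
    (memLp_two_iff_integrable_sq hψ.continuous.aestronglyMeasurable).1 hψL2
  have hnorm' : (∫ x, ψ x ^ 2) = 1 := hnorm
  -- the inequality at cut-off radius `n + 1`
  have hR1 : ∀ n : ℕ, (1 : ℝ) ≤ (n : ℝ) + 1 := fun n => by
    have : (0 : ℝ) ≤ n := Nat.cast_nonneg n
    linarith
  have hstep : ∀ n : ℕ, (2 / 3 * R - E) * (1 - 1 * C * C * Real.exp (-((n : ℝ) + 1)) * K)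
      ≤ (1 / 2 : ℝ) * (M₁ * C * C * Real.exp (-((n : ℝ) + 1)) * K) := by
    intro n
    obtain ⟨hχ, -, hone, habs1, hgrad⟩ := hpack _ (hR1 n)
    set χ := radialCutoff ((n : ℝ) + 1) with hχdef
    -- mass `m = ∫ χ²ψ²` and its tail estimate `m ≥ 1 − C²K e^{−(n+1)}`
    have hint_m : Integrable (fun x => χ x ^ 2 * ψ x ^ 2) (volume : Measure ZM) := by
      refine Integrable.mono' hint_sq ((hχ.1.continuous.pow 2).mul (hψ.continuous.pow 2)).aestronglyMeasurable
        (Eventually.of_forall fun x => ?_)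
      have hm := radialCutoff_mem_Icc ((n : ℝ) + 1) x
      rw [Real.norm_eq_abs, abs_of_nonneg (mul_nonneg (sq_nonneg _) (sq_nonneg _))]
      have : χ x ^ 2 ≤ 1 := by
        rw [hχdef]; nlinarith [hm.1, hm.2]
      nlinarith [sq_nonneg (ψ x)]
    have hm_eq : (∫ x, χ x ^ 2 * ψ x ^ 2) = 1 - ∫ x, (1 - χ x ^ 2) * (ψ x * ψ x) := by
      have e : (fun x => (1 - χ x ^ 2) * (ψ x * ψ x)) = fun x => ψ x ^ 2 - χ x ^ 2 * ψ x ^ 2 := by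
        funext x; ring
      rw [e, integral_sub hint_sq hint_m, hnorm']
      ring
    have htail : |∫ x, (1 - χ x ^ 2) * (ψ x * ψ x)| ≤ 1 * C * C * Real.exp (-((n : ℝ) + 1)) * K :=
      abs_tail_le hC hC habs1 hone
    have hm_ge : 1 - 1 * C * C * Real.exp (-((n : ℝ) + 1)) * K ≤ ∫ x, χ x ^ 2 * ψ x ^ 2 := by
      rw [hm_eq]
      linarith [(abs_le.1 htail).2]
    -- valley bound with `ψ ≡ 0` on the ball: `⅔R·m ≤ E·m + ½T`
    have hval := valley_cutoff_ineq hψ heig hχ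
    have htest : IsTestFn (χ * ψ) := ⟨hχ.1.mul hψ, hχ.2.mul_right⟩
    have hint_w : Integrable (fun x => ‖x‖ * (χ x ^ 2 * ψ x ^ 2)) (volume : Measure ZM) := by
      refine (htest.integrable_mul_sq continuous_norm).congr (Eventually.of_forall fun x => ?_)
      simp only [Pi.mul_apply, mul_pow]
    have hRm : R * (∫ x, χ x ^ 2 * ψ x ^ 2) ≤ ∫ x, ‖x‖ * (χ x ^ 2 * ψ x ^ 2) := by
      rw [← integral_const_mul]
      refine integral_mono (hint_m.const_mul R) hint_w fun x => ?_
      by_cases hx : ‖x‖ < R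
      · simp only [hzero x hx]
        simp
      · exact mul_le_mul_of_nonneg_right (not_lt.1 hx) (mul_nonneg (sq_nonneg _) (sq_nonneg _))
    have hT : |∫ x, ‖gradient χ x‖ ^ 2 * (ψ x * ψ x)| ≤ M₁ * C * C * Real.exp (-((n : ℝ) + 1)) * K :=
      abs_gradTail_le hC hC hgrad hone
    have hT' : (∫ x, ‖gradient χ x‖ ^ 2 * ψ x ^ 2) ≤ M₁ * C * C * Real.exp (-((n : ℝ) + 1)) * K := by
      have e : (∫ x, ‖gradient χ x‖ ^ 2 * ψ x ^ 2) = ∫ x, ‖gradient χ x‖ ^ 2 * (ψ x * ψ x) :=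
        integral_congr_ae (Eventually.of_forall fun x => by simp only [sq])
      rw [e]
      exact (le_abs_self _).trans hT
    -- combine
    have h1 : (2 / 3 * R - E) * (∫ x, χ x ^ 2 * ψ x ^ 2) ≤ (1 / 2 : ℝ) * (M₁ * C * C * Real.exp (-((n : ℝ) + 1)) * K) := by
      nlinarith [hval, hRm, hT']
    exact (mul_le_mul_of_nonneg_left hm_ge hδ.le).trans h1
  -- let `n → ∞`
  have hexp_lim : Tendsto (fun n : ℕ => Real.exp (-((n : ℝ) + 1))) atTop (𝓝 0) := by
    have h1 : Tendsto (fun n : ℕ => (n : ℝ) + 1) atTop atTop :=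
      tendsto_atTop_add_const_right atTop 1 tendsto_natCast_atTop_atTop
    exact Real.tendsto_exp_neg_atTop_nhds_zero.comp h1
  have hL : Tendsto (fun n : ℕ => (2 / 3 * R - E) * (1 - 1 * C * C * Real.exp (-((n : ℝ) + 1)) * K)) atTop
      (𝓝 ((2 / 3 * R - E) * (1 - 0))) := by
    have := ((hexp_lim.const_mul (1 * C * C)).mul_const K).const_sub 1 |>.const_mul (2 / 3 * R - E)
    simpa using this
  have hRt : Tendsto (fun n : ℕ => (1 / 2 : ℝ) * (M₁ * C * C * Real.exp (-((n : ℝ) + 1)) * K)) atTop (𝓝 0) := by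
    have := ((hexp_lim.const_mul (M₁ * C * C)).mul_const K).const_mul (1 / 2 : ℝ)
    simpa using this
  have hle := le_of_tendsto_of_tendsto hL hRt (Eventually.of_forall hstep)
  rw [sub_zero, mul_one] at hle
  exact absurd hle (not_le.2 hδ)

/-- The same for member `j` of a family with the AL1 clauses (`E = physLevel (j+1) ≥ 0`): if `3·physLevel(j+1)/2 < R` then `f_j(y) ≠ 0` for some
`‖y‖ < R`. [cite: SimonB1983DiscreteSpectrum, §2 eq. (5)] [cite: ReedSimonIV1978, Thm. XIII.64] -/
theorem exists_ne_zero_in_ball_of_clauses {k : ℕ} {f : Fin (k + 1) → ZM → ℝ}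
    (hsmooth : ∀ j, ∀ n : ℕ∞, ContDiff ℝ n (f j))
    (horth : ∀ i j, ∫ x, f i x * f j x = if i = j then (1 : ℝ) else 0)
    (heig : ∀ j, ∀ x : ZM, hApply (f j) x = physLevel ((j : ℕ) + 1) * f j x)
    (hdec : ∀ j, ExpDecay₂ (f j)) (j : Fin (k + 1)) {R : ℝ} (hR : 3 / 2 * physLevel ((j : ℕ) + 1) < R) :
    ∃ y : ZM, ‖y‖ < R ∧ f j y ≠ 0 := by
  obtain ⟨C, -, hC⟩ := (hdec j).exists_abs_le
  have hnorm : l2sq (f j) = 1 := by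
    have h := horth j j
    rw [if_pos rfl] at h
    rw [l2sq, ← h]
    exact integral_congr_ae (Eventually.of_forall fun x => by simp only [sq])
  exact exists_ne_zero_in_ball (contDiff_two_of_forall (hsmooth j)) (heig j) hC hnorm hR

end Literature.Analysis.OperatorTheory.YMMatrixModel

end
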